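import Literature.MathematicalPhysics.QuantumFieldTheory.VillainDuality
import Literature.MathematicalPhysics.QuantumFieldTheory.VillainFluxReal
import Literature.Probability.LatticeModels.CoulombGasAlgebra
import HarnessLib

/-!
# The monopole (flux) gas of the Villain model on a cube with the full Laplacian `DDᵀ + EᵀE`:
# an exact, regulator-free form of the Coulomb-gas average of the duality formula

Support file for the Coulomb-gas (monopole) representation of four-dimensional `U(1)` lattice gauge
theory with the Villain action (proof programme of the named fact
`Literature.MathematicalPhysics.QuantumFieldTheory.FrohlichSpencerU1PerimeterLawD4` and of its
corollary `Literature.Barriers.QuantumFields.AbelianDeconfinementD4`). The duality formula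
(`VillainDuality`) averages `cos⟨(2πξ.out)_⊥, S⟩` over flux classes `ξ` with weights
`∝ e^{-2π²β‖(ξ.out)_⊥‖²}`; classes correspond to CLOSED integer cube fields `q = dm`
(`VillainFluxReal`), and on fluxes the Coulomb kernel is the inverse of the full Laplacian
`B' = DDᵀ + EᵀE` (`CoulombGasAlgebra`; FS82 (2.35)). This file instantiates the generic algebra for
the Villain model on `B_n` — `D` the flux map (plaquettes → cubes), `E` the coboundary from cubes
to the 4-CELLS of the box — and rewrites the Coulomb-gas average as a gas over closed integer cube
fields with this kernel:

* `DMat` (+ `DMat_mulVec`, `kerEqRange_dMat`), `fourCellsIn`/`QIdx`, `cobd₃`/`EMat` (`Eq = dq`),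
  `EMat_mulVec_eq_zero_iff` (`Eq = 0 ↔ q` closed), `EMat_mulVec_DMat_mulVec` (`E(Dm) = 0`),
  `exists_DMat_mulVec_eq_of_EMat_mulVec_eq_zero`, `posDef_villainLap`;
* `gasWeight β q = e^{-2π²β⟨q, B'⁻¹q⟩}`, `gasTerm`, `gasNum β S = ∑_q [q closed] gasWeight q cos(2π⟨q, B'⁻¹DS⟩)`,
  `gasDen`, `gasTerm_fluxQuot` (on the flux of a class: `Z⁻¹ g(ξ) cos⟨perpPart dMat (fluxRep ξ), S⟩`),
  summability, and **`gasRatio_eq_dualRatio`**: `gasNum β S / gasDen β` is the ratio of the duality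
  formula — exactly, with no infrared regulator.

Everything is proved; no named fact is introduced.

## References

* J. Fröhlich, T. Spencer, Comm. Math. Phys. 83 (1982) 411–454, §2.5 (2.35), §2.6 (2.43)–(2.44).
  [FrohlichSpencerCMP1982]
-/

noncomputable section

open Finset Function Matrix
open scoped Real
open Literature.Probability.LatticeModels
open Literature.Probability.LatticeModels.GaussianCoord (gram exactPart perpPart exactPreimage exactEnergy KerEqRange lap)
open Literature.MathematicalPhysics.QuantumFieldTheory.GaussianToolkit (gaussZ)

namespace Literature.MathematicalPhysics.QuantumFieldTheory

/-- Sites of `ℤ^d` (the namespace-local `Site` is the torus one). -/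
local notation "ZSite" => Literature.Probability.LatticeModels.Site

namespace VillainAngle

open AxialGauge LatticeForm LatticeChain VillainFibre

variable {d n : ℕ}

/-! ### The real flux matrix and `ker D = range T` -/

/-- **The matrix of the real flux map** `m ↦ dm` (rows: cubes of `B_n`; columns: plaquettes). [folklore] -/
def DMat : Matrix (CIdx d n) (PIdx d n) ℝ := LinearMap.toMatrix' fluxMapR

/-- `D m = dm`. [folklore] -/
theorem DMat_mulVec (m : PIdx d n → ℝ) : DMat *ᵥ m = fluxMapA m := by
  rw [DMat, LinearMap.toMatrix'_mulVec]; rfl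

/-- **`ker D = range T`** (and `DT = 0`) for the Villain model on a cube. [folklore] -/
theorem kerEqRange_dMat : KerEqRange (dMat (d := d) (n := n)) (DMat (d := d) (n := n)) := by
  refine ⟨?_, fun m hm => ?_⟩
  · rw [DMat, dMat, ← LinearMap.toMatrix'_comp]
    have : (fluxMapR (d := d) (n := n)).comp dFreeR = 0 := by
      apply LinearMap.ext
      intro θ
      rw [LinearMap.comp_apply, LinearMap.zero_apply, fluxMapR_apply, ← dFreeA_real, fluxMapA_dFreeA]
    rw [this, map_zero]
  · rw [DMat_mulVec] at hm
    obtain ⟨θ, hθ⟩ := exists_dFreeA_eq_of_fluxMapA_eq_zero m hm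
    exact ⟨θ, by rw [dMat_mulVec, ← dFreeA_real, hθ]⟩

/-! ### The 4-cells of the box and the coboundary `E` from cubes to 4-cells -/

/-- 4-cell labels of `ℤ^d`: a base point and four directions. [folklore] -/
abbrev FourCell (d : ℕ) : Type := ZSite d × Fin d × Fin d × Fin d × Fin d

/-- **The 4-cells of the box**: labels `(x; i, j, k, l)` with `i < j < k < l` and `x`,
`x + eᵢ + eⱼ + e_k + e_l ∈ B_n` (all corners then lie in the box). [folklore] -/
def fourCellsIn (d n : ℕ) : Finset (FourCell d) :=
  ((halfOpenBox d n) ×ˢ (Finset.univ ×ˢ (Finset.univ ×ˢ (Finset.univ ×ˢ Finset.univ)))).filter fun σ =>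
    σ.2.1 < σ.2.2.1 ∧ σ.2.2.1 < σ.2.2.2.1 ∧ σ.2.2.2.1 < σ.2.2.2.2 ∧
      σ.1 + e σ.2.1 + e σ.2.2.1 + e σ.2.2.2.1 + e σ.2.2.2.2 ∈ halfOpenBox d n

/-- Membership in `fourCellsIn`. [folklore] -/
theorem mem_fourCellsIn {σ : FourCell d} :
    σ ∈ fourCellsIn d n ↔ σ.1 ∈ halfOpenBox d n ∧ σ.2.1 < σ.2.2.1 ∧ σ.2.2.1 < σ.2.2.2.1 ∧
      σ.2.2.2.1 < σ.2.2.2.2 ∧ σ.1 + e σ.2.1 + e σ.2.2.1 + e σ.2.2.2.1 + e σ.2.2.2.2 ∈ halfOpenBox d n := by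
  simp only [fourCellsIn, Finset.mem_filter, Finset.mem_product, Finset.mem_univ, and_true]

variable (d n) in
/-- The 4-cells of `B_n` as an index type. [folklore] -/
abbrev QIdx : Type := ↥(fourCellsIn d n)

/-- `v ↦ (dv)(σ)` is additive. [folklore] -/
theorem cd₃_extCubeA_add (v w : CIdx d n → ℝ) (x : ZSite d) (i j k l : Fin d) :
    cd₃ (extCubeA (v + w)) x i j k l = cd₃ (extCubeA v) x i j k l + cd₃ (extCubeA w) x i j k l := by
  have : extCubeA (v + w) = extCubeA v + extCubeA w := by
    funext y a b c; simp only [extCubeA, Pi.add_apply]; split_ifs <;> simp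
  rw [this]
  simp only [cd₃, Pi.add_apply]
  abel

/-- `v ↦ (dv)(σ)` is homogeneous. [folklore] -/
theorem cd₃_extCubeA_smul (t : ℝ) (v : CIdx d n → ℝ) (x : ZSite d) (i j k l : Fin d) :
    cd₃ (extCubeA (t • v)) x i j k l = t * cd₃ (extCubeA v) x i j k l := by
  have : extCubeA (t • v) = t • extCubeA v := by
    funext y a b c; simp only [extCubeA, Pi.smul_apply, smul_eq_mul]; split_ifs <;> simp
  rw [this]
  simp only [cd₃, Pi.smul_apply, smul_eq_mul]
  ring

/-- **The real coboundary from the cubes to the 4-cells of the box** (`q ↦ dq`) as a linear map.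
[cite: FrohlichSpencerCMP1982, §2.3 (2.11)–(2.13)] -/
def cobd₃ : (CIdx d n → ℝ) →ₗ[ℝ] (QIdx d n → ℝ) where
  toFun q σ := cd₃ (extCubeA q) σ.1.1 σ.1.2.1 σ.1.2.2.1 σ.1.2.2.2.1 σ.1.2.2.2.2
  map_add' v w := by funext σ; exact cd₃_extCubeA_add v w _ _ _ _ _
  map_smul' t v := by funext σ; exact cd₃_extCubeA_smul t v _ _ _ _ _

/-- Unfolding `cobd₃`. [folklore] -/
theorem cobd₃_apply (q : CIdx d n → ℝ) (σ : QIdx d n) :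
    cobd₃ q σ = cd₃ (extCubeA q) σ.1.1 σ.1.2.1 σ.1.2.2.1 σ.1.2.2.2.1 σ.1.2.2.2.2 := rfl

/-- **The matrix `E` of `q ↦ dq`** (rows: 4-cells; columns: cubes). [folklore] -/
def EMat : Matrix (QIdx d n) (CIdx d n) ℝ := LinearMap.toMatrix' cobd₃

/-- `E q = dq`. [folklore] -/
theorem EMat_mulVec (q : CIdx d n → ℝ) : EMat *ᵥ q = cobd₃ q := by
  rw [EMat, LinearMap.toMatrix'_mulVec]

/-- **`E q = 0 ↔ q` is closed** (the real version of `IsClosedFlux`). [folklore] -/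
theorem EMat_mulVec_eq_zero_iff (q : CIdx d n → ℝ) : EMat *ᵥ q = 0 ↔ IsClosedFlux q := by
  rw [EMat_mulVec]
  constructor
  · intro h x i j k l hij hjk hkl hx hx4
    have hσ : (x, i, j, k, l) ∈ fourCellsIn d n :=
      mem_fourCellsIn.2 ⟨hx, Fin.lt_def.2 hij, Fin.lt_def.2 hjk, Fin.lt_def.2 hkl, hx4⟩
    have := congrFun h ⟨(x, i, j, k, l), hσ⟩
    rwa [cobd₃_apply] at this
  · intro h
    funext σ
    obtain ⟨⟨x, i, j, k, l⟩, hσ⟩ := σ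
    obtain ⟨hx, hij, hjk, hkl, hx4⟩ := mem_fourCellsIn.1 hσ
    rw [cobd₃_apply, Pi.zero_apply]
    exact h x i j k l (Fin.lt_def.1 hij) (Fin.lt_def.1 hjk) (Fin.lt_def.1 hkl) hx hx4

/-- **`E (D m) = 0`** (`d ∘ d = 0` on the box). [cite: FrohlichSpencerCMP1982, §2.3 (2.13)] -/
theorem EMat_mulVec_DMat_mulVec (m : PIdx d n → ℝ) : EMat *ᵥ (DMat (d := d) (n := n) *ᵥ m) = 0 := by
  rw [DMat_mulVec]
  exact (EMat_mulVec_eq_zero_iff (fluxMapA m)).2 (isClosedFlux_fluxMapA m)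

/-- **Real closed fields are real fluxes**: `E q = 0 → q = D m`. [folklore] -/
theorem exists_DMat_mulVec_eq_of_EMat_mulVec_eq_zero (q : CIdx d n → ℝ) (hq : EMat *ᵥ q = 0) :
    ∃ m : PIdx d n → ℝ, DMat *ᵥ m = q := by
  obtain ⟨m, hm⟩ := exists_eq_fluxMapA_of_isClosedFlux q ((EMat_mulVec_eq_zero_iff q).1 hq)
  exact ⟨m, by rw [DMat_mulVec, hm]⟩

/-! ### The full Laplacian of the Villain model on the cube -/

/-- **The full Laplacian `B' = DDᵀ + EᵀE` on cube fields is positive definite.** [cite: FrohlichSpencerCMP1982, §2.5 (2.35)] -/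
theorem posDef_villainLap : (lap (DMat (d := d) (n := n)) (EMat (d := d) (n := n))).PosDef :=
  GaussianCoord.posDef_lap _ _ exists_DMat_mulVec_eq_of_EMat_mulVec_eq_zero

/-- **`Dᵀ B'⁻¹ D m = m_⊥`** for the Villain model on the cube. [cite: FrohlichSpencerCMP1982, §2.5 (2.35), §2.7 (2.51)–(2.52)] -/
theorem transpose_DMat_mulVec_inv_lap_flux (m : PIdx d n → ℝ) :
    (DMat (d := d) (n := n))ᵀ *ᵥ ((lap (DMat (d := d) (n := n)) (EMat (d := d) (n := n)))⁻¹ *ᵥ (DMat *ᵥ m)) =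
      perpPart dMat m :=
  GaussianCoord.transpose_mulVec_inv_lap_flux _ _ _ posDef_gram_dMat kerEqRange_dMat EMat_mulVec_DMat_mulVec
    exists_DMat_mulVec_eq_of_EMat_mulVec_eq_zero m

/-- `⟨Dm, B'⁻¹Dm'⟩ = ⟨m'_⊥, m⟩`. [cite: FrohlichSpencerCMP1982, §2.7 (2.52)–(2.54)] -/
theorem flux_dotProduct_inv_lap (m m' : PIdx d n → ℝ) :
    (DMat *ᵥ m) ⬝ᵥ ((lap (DMat (d := d) (n := n)) (EMat (d := d) (n := n)))⁻¹ *ᵥ (DMat *ᵥ m')) = perpPart dMat m' ⬝ᵥ m :=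
  GaussianCoord.flux_dotProduct_inv_lap_flux _ _ _ posDef_gram_dMat kerEqRange_dMat EMat_mulVec_DMat_mulVec
    exists_DMat_mulVec_eq_of_EMat_mulVec_eq_zero m m'

/-- `⟨Dm, B'⁻¹Dm⟩ = ‖m_⊥‖²`. [cite: FrohlichSpencerCMP1982, §2.5 (2.35)] -/
theorem flux_dotProduct_inv_lap_self (m : PIdx d n → ℝ) :
    (DMat *ᵥ m) ⬝ᵥ ((lap (DMat (d := d) (n := n)) (EMat (d := d) (n := n)))⁻¹ *ᵥ (DMat *ᵥ m)) =
      perpPart dMat m ⬝ᵥ perpPart dMat m :=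
  GaussianCoord.flux_dotProduct_inv_lap_flux_self _ _ _ posDef_gram_dMat kerEqRange_dMat EMat_mulVec_DMat_mulVec
    exists_DMat_mulVec_eq_of_EMat_mulVec_eq_zero m

/-! ### The gas over closed integer cube fields -/

/-- **The Coulomb weight** `e^{-2π²β⟨q, B'⁻¹q⟩}` of an integer cube field. [cite: FrohlichSpencerCMP1982, §2.4 (2.24), §2.5 (2.35)] -/
def gasWeight (β : ℝ) (q : CIdx d n → ℤ) : ℝ :=
  Real.exp (-(2 * π ^ 2 * β) *
    ((fun c => (q c : ℝ)) ⬝ᵥ ((lap (DMat (d := d) (n := n)) (EMat (d := d) (n := n)))⁻¹ *ᵥ fun c => (q c : ℝ))))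

/-- The weights are positive. [folklore] -/
theorem gasWeight_pos (β : ℝ) (q : CIdx d n → ℤ) : 0 < gasWeight β q := Real.exp_pos _

open Classical in
/-- **The `q`-th term of the gas**: `[q closed] e^{-2π²β⟨q,B'⁻¹q⟩} cos(2π⟨q, B'⁻¹ D S⟩)`.
[cite: FrohlichSpencerCMP1982, §2.6 (2.43)–(2.44), §2.7 (2.52)–(2.54)] -/
def gasTerm (β : ℝ) (S : PIdx d n → ℝ) (q : CIdx d n → ℤ) : ℝ :=
  if IsClosedFlux q then
    gasWeight β q * Real.cos (2 * π *
      ((fun c => (q c : ℝ)) ⬝ᵥ ((lap (DMat (d := d) (n := n)) (EMat (d := d) (n := n)))⁻¹ *ᵥ (DMat *ᵥ S))))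
  else 0

/-- **The numerator of the gas**: `∑_{q closed} e^{-2π²β⟨q,B'⁻¹q⟩} cos(2π⟨q, B'⁻¹DS⟩)`. [cite: FrohlichSpencerCMP1982, §2.4 (2.24)] -/
def gasNum (β : ℝ) (S : PIdx d n → ℝ) : ℝ := ∑' q : CIdx d n → ℤ, gasTerm β S q

/-- **The partition function of the gas**: `∑_{q closed} e^{-2π²β⟨q,B'⁻¹q⟩}`. [cite: FrohlichSpencerCMP1982, §2.4 (2.24)] -/
def gasDen (β : ℝ) : ℝ := gasNum (d := d) (n := n) β 0

/-- The terms vanish off the fluxes of classes. [folklore] -/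
theorem support_gasTerm_subset (β : ℝ) (S : PIdx d n → ℝ) :
    Function.support (gasTerm (d := d) (n := n) β S) ⊆ Set.range (fluxQuot (d := d) (n := n)) := by
  classical
  intro q hq
  rw [Function.mem_support] at hq
  by_cases hcl : IsClosedFlux q
  · obtain ⟨m, hm⟩ := exists_eq_fluxMapA_of_isClosedFlux q hcl
    exact ⟨QuotientAddGroup.mk m, by rw [fluxQuot_mk, ← fluxMapA_int, hm]⟩
  · exact absurd (by simp [gasTerm, hcl]) hq

/-- `perpPart` is additive. [folklore] -/
theorem perpPart_add {ι κ : Type*} [Fintype ι] [Fintype κ] [DecidableEq ι] (T : Matrix κ ι ℝ) (v w : κ → ℝ) :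
    perpPart T (v + w) = perpPart T v + perpPart T w := by
  simp only [perpPart, exactPart, Matrix.mulVec_add]
  abel

/-- `perpPart` is homogeneous. [folklore] -/
theorem perpPart_smul {ι κ : Type*} [Fintype ι] [Fintype κ] [DecidableEq ι] (T : Matrix κ ι ℝ) (t : ℝ) (v : κ → ℝ) :
    perpPart T (t • v) = t • perpPart T v := by
  simp only [perpPart, exactPart, Matrix.mulVec_smul, smul_sub]

/-- `⟨p(m), S⟩ = ⟨p(m), p(S)⟩`: the orthogonal part is orthogonal to exact parts. [folklore] -/
theorem perpPart_dotProduct_eq {ι κ : Type*} [Fintype ι] [Fintype κ] [DecidableEq ι] (T : Matrix κ ι ℝ)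
    (hM : (gram T).PosDef) (m S : κ → ℝ) : perpPart T m ⬝ᵥ S = perpPart T m ⬝ᵥ perpPart T S := by
  have hS : exactPart T S + perpPart T S = S := by rw [perpPart]; abel
  rw [← congrArg (perpPart T m ⬝ᵥ ·) hS, dotProduct_add, exactPart, dotProduct_comm (perpPart T m),
    GaussianCoord.mulVec_dotProduct_eq, GaussianCoord.transpose_mulVec_perpPart T hM, dotProduct_zero, zero_add]

/-- `⟨p(m), S⟩ = ⟨p(S), m⟩`. [folklore] -/
theorem perpPart_dotProduct_comm {ι κ : Type*} [Fintype ι] [Fintype κ] [DecidableEq ι] (T : Matrix κ ι ℝ)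
    (hM : (gram T).PosDef) (m S : κ → ℝ) : perpPart T m ⬝ᵥ S = perpPart T S ⬝ᵥ m := by
  rw [perpPart_dotProduct_eq T hM m S, perpPart_dotProduct_eq T hM S m, dotProduct_comm]

/-- The Coulomb weight of the duality formula: `g(ξ) = Z · exp(-2π²β ‖(ξ.out)_⊥‖²)`. [folklore] -/
theorem coulombWeight_eq (β : ℝ) (ξ : (PIdx d n → ℤ) ⧸ (dFree (d := d) (n := n)).range) :
    coulombWeight β ξ = (gaussZ (β • gram (dMat (d := d) (n := n)))).toReal *
      Real.exp (-(2 * π ^ 2 * β) * (perpPart dMat (fun p => (ξ.out p : ℝ)) ⬝ᵥ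
          perpPart dMat (fun p => (ξ.out p : ℝ)))) := by
  rw [coulombWeight, fluxRep, perpPart_smul, smul_dotProduct, dotProduct_smul, smul_eq_mul, smul_eq_mul]
  congr 2
  ring

/-- The phase of the duality formula: `⟨perpPart dMat (fluxRep ξ), S⟩ = 2π ⟨(ξ.out)_⊥, S⟩`. [folklore] -/
theorem perpPart_fluxRep_dotProduct (ξ : (PIdx d n → ℤ) ⧸ (dFree (d := d) (n := n)).range) (S : PIdx d n → ℝ) :
    perpPart dMat (fluxRep ξ) ⬝ᵥ S = 2 * π * (perpPart dMat (fun p => (ξ.out p : ℝ)) ⬝ᵥ S) := by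
  rw [fluxRep, perpPart_smul, smul_dotProduct, smul_eq_mul]

/-- **The term at the flux of a class**: `Z⁻¹ g(ξ) cos⟨perpPart dMat (fluxRep ξ), S⟩` (`β > 0`).
[cite: FrohlichSpencerCMP1982, §2.5 (2.35), §2.7 (2.52)–(2.54)] -/
theorem gasTerm_fluxQuot {β : ℝ} (hβ : 0 < β) (S : PIdx d n → ℝ) (ξ : (PIdx d n → ℤ) ⧸ (dFree (d := d) (n := n)).range) :
    gasTerm β S (fluxQuot ξ) = ((gaussZ (β • gram (dMat (d := d) (n := n)))).toReal)⁻¹ *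
      (coulombWeight β ξ * Real.cos (perpPart dMat (fluxRep ξ) ⬝ᵥ S)) := by
  classical
  have hcl : IsClosedFlux (fluxQuot ξ) := by
    rw [← fluxMap_out, ← fluxMapA_int]; exact isClosedFlux_fluxMapA _
  have hq : (fun c => ((fluxQuot ξ) c : ℝ)) = DMat *ᵥ fun p => (ξ.out p : ℝ) := by
    rw [DMat_mulVec, fluxMapA_intCast, fluxMap_out]
  have hZ : (gaussZ (β • gram (dMat (d := d) (n := n)))).toReal ≠ 0 :=
    (GaussianCoord.gaussZ_toReal_pos _ (posDef_gram_dMat.smul hβ)).ne'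
  unfold gasTerm
  rw [if_pos hcl, gasWeight, hq, flux_dotProduct_inv_lap_self, flux_dotProduct_inv_lap, coulombWeight_eq,
    perpPart_fluxRep_dotProduct, perpPart_dotProduct_comm _ posDef_gram_dMat S]
  field_simp

/-- The reindexed family of terms. [folklore] -/
theorem gasTerm_comp_fluxQuot {β : ℝ} (hβ : 0 < β) (S : PIdx d n → ℝ) :
    (gasTerm (d := d) (n := n) β S) ∘ fluxQuot = fun ξ => ((gaussZ (β • gram (dMat (d := d) (n := n)))).toReal)⁻¹ *
      (coulombWeight β ξ * Real.cos (perpPart dMat (fluxRep ξ) ⬝ᵥ S)) := by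
  funext ξ; exact gasTerm_fluxQuot hβ S ξ

/-- **The gas is absolutely convergent** (`β > 0`). [folklore] -/
theorem summable_gasTerm {β : ℝ} (hβ : 0 < β) (S : PIdx d n → ℝ) : Summable (gasTerm (d := d) (n := n) β S) := by
  rw [← fluxQuot_injective.summable_iff (fun q hq => ?_), gasTerm_comp_fluxQuot hβ]
  · exact ((setIntegral_tsum_angleTerm_eq (d := d) (n := n) hβ S).1).mul_left _
  · by_contra h
    exact hq (support_gasTerm_subset β S (Function.mem_support.2 h))

/-- **The numerator as the sum of the duality formula**: `gasNum β S = Z⁻¹ ∑_ξ g(ξ) cos⟨perpPart dMat (fluxRep ξ), S⟩`.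
[cite: FrohlichSpencerCMP1982, §2.4 (2.24)] -/
theorem gasNum_eq {β : ℝ} (hβ : 0 < β) (S : PIdx d n → ℝ) :
    gasNum β S = ((gaussZ (β • gram (dMat (d := d) (n := n)))).toReal)⁻¹ *
      ∑' ξ : (PIdx d n → ℤ) ⧸ (dFree (d := d) (n := n)).range,
        coulombWeight β ξ * Real.cos (perpPart dMat (fluxRep ξ) ⬝ᵥ S) := by
  rw [gasNum, ← fluxQuot_injective.tsum_eq (support_gasTerm_subset β S), ← tsum_mul_left]
  exact tsum_congr fun ξ => gasTerm_fluxQuot hβ S ξ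

/-- **The partition function as the sum of the Coulomb weights**: `gasDen β = Z⁻¹ ∑_ξ g(ξ)`. [cite: FrohlichSpencerCMP1982, §2.4 (2.24)] -/
theorem gasDen_eq {β : ℝ} (hβ : 0 < β) :
    gasDen (d := d) (n := n) β = ((gaussZ (β • gram (dMat (d := d) (n := n)))).toReal)⁻¹ *
      ∑' ξ : (PIdx d n → ℤ) ⧸ (dFree (d := d) (n := n)).range, coulombWeight β ξ := by
  rw [gasDen, gasNum_eq hβ]
  congr 1
  exact tsum_congr fun ξ => by rw [dotProduct_zero, Real.cos_zero, mul_one]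

/-- The partition function is positive (`β > 0`). [folklore] -/
theorem gasDen_pos {β : ℝ} (hβ : 0 < β) : 0 < gasDen (d := d) (n := n) β := by
  rw [gasDen_eq hβ]
  have hsumg : Summable fun ξ : (PIdx d n → ℤ) ⧸ (dFree (d := d) (n := n)).range => coulombWeight β ξ := by
    have := (setIntegral_tsum_angleTerm_eq (d := d) (n := n) hβ 0).1
    simpa using this
  have h1 := hsumg.le_tsum (QuotientAddGroup.mk 0) fun ξ _ => (coulombWeight_pos hβ ξ).le
  exact mul_pos (inv_pos.2 (GaussianCoord.gaussZ_toReal_pos _ (posDef_gram_dMat.smul hβ)))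
    ((coulombWeight_pos hβ _).trans_le h1)

/-- **The Coulomb-gas average of the duality formula is the gas ratio** (exact, regulator-free):
`gasNum β S / gasDen β = (∑_ξ g(ξ) cos⟨perpPart dMat (fluxRep ξ), S⟩) / ∑_ξ g(ξ)` (`β > 0`).
[cite: FrohlichSpencerCMP1982, §2.4 (2.24), §2.5 (2.35)] -/
theorem gasRatio_eq_dualRatio {β : ℝ} (hβ : 0 < β) (S : PIdx d n → ℝ) :
    gasNum β S / gasDen (d := d) (n := n) β =
      (∑' ξ : (PIdx d n → ℤ) ⧸ (dFree (d := d) (n := n)).range,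
          coulombWeight β ξ * Real.cos (perpPart dMat (fluxRep ξ) ⬝ᵥ S)) /
        ∑' ξ : (PIdx d n → ℤ) ⧸ (dFree (d := d) (n := n)).range, coulombWeight β ξ := by
  rw [gasNum_eq hβ, gasDen_eq hβ, mul_div_mul_left]
  exact inv_ne_zero (GaussianCoord.gaussZ_toReal_pos _ (posDef_gram_dMat.smul hβ)).ne'

end VillainAngle

end Literature.MathematicalPhysics.QuantumFieldTheory
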